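import Literature.Computability.AlgebraicComplexity.TokenCircuits
import HarnessLib

/-!
# The token expansion of a normalized circuit, I: cuts, demands, validity

For a normalized circuit `N : NCirc R` (`TokenCircuits.lean`) with budget `D` and its factor
system `N.FS D hD hm hroot`, the files `TokenExpansion*.lean` prove, for EVERY admissible
realisation `F` of the factors,

  `∑_{b : Var → Bool} ∏_f F f b = ∑_{e : Fin u → Bool} val e (m - 1)`     (`NCirc.sum_prod_factors`)

— the Boolean sum of the circuit over its Boolean leaves (Malod–Portier 2008, proof of Thm. 2:
the monomials of the sum over the edge variables are the parse trees; here in a token form in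
which every variable is read twice, as `FactorSystem.exists_permanent` requires). The proof is a
CUT INDUCTION over the node order: `W_k(β)` = the sum over the assignments agreeing with `β` on
the variables with source `≥ k` of the product of the factors of the nodes `< k`; for a VALID
demand `β` across the cut (the set tokens crossing the cut have pairwise disjoint ranges
`[c, c + fd)`, so every clone is demanded at most once and the factors are only evaluated on
inputs that matter) one has `W_k(β) = ∑_{e ∈ Rep_k} ∏_{v ∈ dem_k β} val_e (target v)`.

This file: `Agree`, `nodeΦ`, `prodBelow`, `prodAt`, `W`, `rangeOf`, `dem`, `tgtN`, `Valid`,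
`Rep`, `ext`, `RHS`; locality `nodeΦ_le_src`, `prodAt_congr` and the fibre decomposition
`W_succ`; the inputs that matter `countP_ins_le_one`, `care_of_valid`; the splitting
`dem_{k+1} = demLow ⊔ demAt`, `dem_of_ext`, `RHS_succ_eq`; `prodAt` over offsets `prodAt_eq`,
`prodAt_eq_evar`, `F_cl_eq_spec`; demanded offsets `sdem`, `cvalid_of_sdem`, `card_demAt_eq`.

## References

* G. Malod, N. Portier, *Characterizing Valiant's algebraic complexity classes*, J. Complexity
  24 (2008) 16–38: Lemma 2 (reduced circuits) and Thm. 2 with its proof (the local conditions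
  (1)–(4) of a parse tree, pp. 8–9 of the MFCS 2006 version).
* P. Bürgisser, *On defining integers and proving arithmetic circuit lower bounds*,
  Comput. Complexity 18 (2009) 81–103, Thm. 2.10 (ECCC TR06-113, p. 8).
-/

namespace Literature.Computability.AlgebraicComplexity

open Finset

universe u

namespace NCirc

variable {R : Type u} [CommRing R] (N : NCirc R) (D : ℕ) (hD : 1 ≤ D) (hm : 0 < N.m)

/-! ### Agreement above a cut, the partial sums `W_k` -/

/-- `b` agrees with `β` on all variables whose source is `≥ k`. [folklore] -/
def Agree (k : ℕ) (β b : N.Var D → Bool) : Prop := ∀ v, k ≤ N.src D v → b v = β v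

/-- Agreement above a cut is decidable. [folklore] -/
instance (k : ℕ) (β b : N.Var D → Bool) : Decidable (N.Agree D k β b) := by
  unfold Agree; infer_instance

/-- The node a factor belongs to: clone factors to their node, the root factor to `m`, the chain
end of the Boolean leaf `k` to `k`. [folklore] -/
def nodeΦ : N.Φ D → ℕ
  | Sum.inl κ => κ.1.val
  | Sum.inr (Sum.inl _) => N.m
  | Sum.inr (Sum.inr k) => k.val

/-- The product of the factors of the nodes `< k`. [folklore] -/
noncomputable def prodBelow (F : Fin (N.mF D) → (N.Var D → Bool) → R) (k : ℕ) (b : N.Var D → Bool) : R :=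
  ∏ x ∈ univ.filter (fun x : N.Φ D => N.nodeΦ D x < k), F (N.enc D x) b

/-- The product of the factors of the node `k`. [folklore] -/
noncomputable def prodAt (F : Fin (N.mF D) → (N.Var D → Bool) → R) (k : ℕ) (b : N.Var D → Bool) : R :=
  ∏ x ∈ univ.filter (fun x : N.Φ D => N.nodeΦ D x = k), F (N.enc D x) b

/-- **The partial sums** `W_k(β) = ∑_{b agreeing with β above k} ∏_{factors of nodes < k} F`. [folklore] -/
noncomputable def W (F : Fin (N.mF D) → (N.Var D → Bool) → R) (k : ℕ) (β : N.Var D → Bool) : R :=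
  ∑ b ∈ univ.filter (fun b => N.Agree D k β b), N.prodBelow D F k b

/-- Splitting off the factors of the node `k`. [folklore] -/
theorem prodBelow_succ (F : Fin (N.mF D) → (N.Var D → Bool) → R) (k : ℕ) (b : N.Var D → Bool) :
    N.prodBelow D F (k + 1) b = N.prodAt D F k b * N.prodBelow D F k b := by
  unfold prodBelow prodAt
  rw [← Finset.prod_union]
  · congr 1
    ext x
    simp only [Finset.mem_filter, Finset.mem_univ, true_and, Finset.mem_union]
    omega
  · rw [Finset.disjoint_filter]
    intro x _ h
    omega

/-! ### Ranges, demand, validity -/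

/-- The range of leaf positions a clone `(i, c)` is responsible for: `[c, c + fd i)`. [cite: MalodPortier2008, Lemma 2] -/
def rangeOf (κ : ℕ × ℕ) : Finset ℕ := Finset.Ico κ.2 (κ.2 + N.fd κ.1)

/-- **The demand across the cut `k`**: the set demand variables (tokens and `t₀`) of `β` leaving
from a source `≥ k` and targeting a node `< k`. [folklore] -/
noncomputable def dem (k : ℕ) (β : N.Var D → Bool) : Finset (N.Var D) :=
  univ.filter fun v => β v = true ∧ k ≤ N.src D v ∧ ∃ κ, N.tgtV D v = some κ ∧ κ.1 < k

/-- The target of a demand variable (junk `(0,0)` for chain variables). [folklore] -/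
def tgtN (v : N.Var D) : ℕ × ℕ := (N.tgtV D v).getD (0, 0)

/-- **Validity of a demand above the cut `k`**: the set demand variables targeting nodes `< k`
have pairwise disjoint ranges (so each clone is demanded at most once, and the demanded clones
can be the roots of a parse forest). [cite: MalodPortier2008, Lemma 2] -/
def Valid (k : ℕ) (β : N.Var D → Bool) : Prop :=
  ∀ v ∈ N.dem D k β, ∀ w ∈ N.dem D k β, v ≠ w →
    Disjoint (N.rangeOf (N.tgtN D v)) (N.rangeOf (N.tgtN D w))

/-- Boolean points of the Boolean leaves supported below `k`: representatives `e` with `e j = false`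
for `j ≥ k` (and, always, for `j ≥ u`). [folklore] -/
def Rep (k : ℕ) : Finset (Fin N.u → Bool) :=
  univ.filter fun e => ∀ j : Fin N.u, k ≤ j.val → e j = false

/-- Extending a Boolean point of the leaves by `false`. [folklore] -/
def ext (e : Fin N.u → Bool) : ℕ → Bool := fun i => if h : i < N.u then e ⟨i, h⟩ else false

/-- **The value predicted for `W_k(β)`**: `∑_{e ∈ Rep_k} ∏_{v ∈ dem_k β} val_e (target node of v)`. [folklore] -/
noncomputable def RHS (k : ℕ) (β : N.Var D → Bool) : R :=
  ∑ e ∈ N.Rep k, ∏ v ∈ N.dem D k β, N.val (N.ext e) (N.tgtN D v).1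

/-! ### Locality of the factors of a node; the fibre decomposition of `W_{k+1}` -/

/-- Every variable read by a factor has its source at or above the factor's node. [folklore] -/
theorem nodeΦ_le_src (x : N.Φ D) (v : N.Var D) (hv : v ∈ (N.kindΦ D hD x).slots) :
    N.nodeΦ D x ≤ N.src D v := by
  rcases x with κ | ⟨z⟩ | k
  · -- clone factor
    simp only [kindΦ_inl] at hv
    by_cases hval : N.CValid D κ
    · rw [N.cloneKind_eq D κ hval rfl] at hv
      have key : ∀ (k : NK R) (hk : N.kind κ.1.val = k), v ∈ (N.cloneKindOf D κ hval k hk).slots →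
          κ.1.val ≤ N.src D v := by
        intro k hk hv
        -- incoming variables
        have hins : v ∈ N.ins D κ → κ.1.val ≤ N.src D v := by
          intro h
          rcases (N.mem_ins_iff D κ v).1 h with ⟨τ, rfl, hτ⟩ | ⟨-, rfl⟩
          · have := N.tgt_spec D τ
            simp only [src]
            have h1 : (N.tgt D τ).1 = κ.1.val := by rw [hτ]
            omega
          · simp only [src, t0]
            exact κ.1.isLt.le
        cases k with
        | leaf ℓ => exact hins hv
        | mul a b =>
          simp only [cloneKindOf, FKind.slots, List.mem_cons] at hv
          rcases hv with rfl | rfl | hv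
          · exact le_rfl
          · exact le_rfl
          · exact hins hv
        | add a b =>
          simp only [cloneKindOf, FKind.slots, List.mem_cons] at hv
          rcases hv with rfl | rfl | hv
          · exact le_rfl
          · exact le_rfl
          · exact hins hv
        | pass c a =>
          simp only [cloneKindOf, FKind.slots, List.mem_cons] at hv
          rcases hv with rfl | hv
          · exact le_rfl
          · exact hins hv
        | evar =>
          simp only [cloneKindOf] at hv
          have e2 : ∀ (c : ℕ) (hc : κ.2.val = c) hu hc', v ∈ (N.evarKind D κ hu hc' c hc).slots →
              κ.1.val ≤ N.src D v := by
            intro c hc hu hc' hv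
            cases c with
            | zero =>
              simp only [evarKind, FKind.slots, List.mem_cons] at hv
              rcases hv with rfl | hv
              · exact le_rfl
              · exact hins hv
            | succ c =>
              simp only [evarKind, FKind.slots, List.mem_cons] at hv
              rcases hv with rfl | rfl | hv
              · exact le_rfl
              · exact le_rfl
              · exact hins hv
          exact e2 _ rfl _ _ hv
      exact key _ rfl hv
    · rw [N.cloneKind_of_not D κ hval] at hv
      simp [FKind.slots] at hv
  · simp only [kindΦ_root, FKind.slots, List.mem_singleton] at hv
    subst hv
    exact le_rfl
  · simp only [kindΦ_fin, FKind.slots, List.mem_singleton] at hv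
    subst hv
    exact le_rfl

/-- The restriction of an assignment to the variables with source `≥ k` (`false` below). [folklore] -/
def restr (k : ℕ) (b : N.Var D → Bool) : N.Var D → Bool := fun v => if k ≤ N.src D v then b v else false

/-- The extensions of `β` down to the node `k`: agree with `β` above `k`, vanish below `k`. [folklore] -/
noncomputable def Ext (k : ℕ) (β : N.Var D → Bool) : Finset (N.Var D → Bool) :=
  univ.filter fun β' => N.Agree D (k + 1) β β' ∧ ∀ v, N.src D v < k → β' v = false

/-- **The factors of node `k` only read variables with source `≥ k`.** [folklore] -/
theorem prodAt_congr (F : Fin (N.mF D) → (N.Var D → Bool) → R)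
    (hloc : ∀ f b b', (∀ v ∈ (N.kindF D hD f).slots, b v = b' v) → F f b = F f b')
    (k : ℕ) (b b' : N.Var D → Bool) (h : ∀ v, k ≤ N.src D v → b v = b' v) :
    N.prodAt D F k b = N.prodAt D F k b' := by
  unfold prodAt
  refine Finset.prod_congr rfl fun x hx => hloc _ _ _ fun v hv => h v ?_
  rw [Finset.mem_filter] at hx
  rw [N.kindF_enc] at hv
  exact hx.2 ▸ N.nodeΦ_le_src D hD x v hv

/-- **The fibre decomposition**: `W_{k+1}(β) = ∑_{β' ∈ Ext_k β} (∏ node-k factors)(β') · W_k(β')`. [folklore] -/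
theorem W_succ (F : Fin (N.mF D) → (N.Var D → Bool) → R)
    (hloc : ∀ f b b', (∀ v ∈ (N.kindF D hD f).slots, b v = b' v) → F f b = F f b')
    (k : ℕ) (β : N.Var D → Bool) :
    N.W D F (k + 1) β = ∑ β' ∈ N.Ext D k β, N.prodAt D F k β' * N.W D F k β' := by
  unfold W
  simp_rw [N.prodBelow_succ]
  rw [← Finset.sum_fiberwise_of_maps_to (g := N.restr D k) (t := N.Ext D k β)]
  · refine Finset.sum_congr rfl fun β' hβ' => ?_
    unfold Ext at hβ'
    rw [Finset.mem_filter] at hβ'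
    obtain ⟨-, hag, hzero⟩ := hβ'
    rw [Finset.mul_sum]
    -- the fibre of `β'` is the set of `b` agreeing with `β'` above `k`
    have hfib : (univ.filter fun b => N.Agree D (k + 1) β b).filter (fun b => N.restr D k b = β') =
        univ.filter fun b => N.Agree D k β' b := by
      ext b
      simp only [Finset.mem_filter, Finset.mem_univ, true_and]
      constructor
      · rintro ⟨-, rfl⟩ v hv
        simp [restr, hv]
      · intro hb
        refine ⟨fun v hv => ?_, ?_⟩
        · rw [hb v (by omega), hag v hv]
        · funext v
          unfold restr
          split_ifs with h
          · exact hb v h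
          · exact (hzero v (by omega)).symm
    rw [hfib]
    refine Finset.sum_congr rfl fun b hb => ?_
    rw [Finset.mem_filter] at hb
    rw [N.prodAt_congr D hD F hloc k b β' (fun v hv => hb.2 v hv)]
  · intro b hb
    unfold Ext
    rw [Finset.mem_filter] at hb ⊢
    refine ⟨Finset.mem_univ _, fun v hv => ?_, fun v hv => ?_⟩
    · simp only [restr, show k ≤ N.src D v by omega, if_true]
      exact hb.2 v hv
    · simp [restr, show ¬ k ≤ N.src D v by omega]

/-! ### Incoming demand of a clone; the inputs that matter -/

/-- The target of an incoming variable of a clone is that clone. [folklore] -/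
theorem tgtN_of_mem_ins (κ : N.Clone D) (v : N.Var D) (hv : v ∈ N.ins D κ) :
    N.tgtV D v = some (κ.1.val, κ.2.val) := by
  rcases (N.mem_ins_iff D κ v).1 hv with ⟨τ, rfl, hτ⟩ | ⟨hr, rfl⟩
  · simp [tgtV, hτ]
  · obtain ⟨h1, h2⟩ := hr
    simp [tgtV, t0, h1, h2]

/-- Incoming variables have their source strictly above the clone's node. [folklore] -/
theorem lt_src_of_mem_ins (κ : N.Clone D) (v : N.Var D) (hv : v ∈ N.ins D κ) :
    κ.1.val < N.src D v := by
  rcases (N.mem_ins_iff D κ v).1 hv with ⟨τ, rfl, hτ⟩ | ⟨-, rfl⟩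
  · have := (N.tgt_spec D τ).1
    rw [hτ] at this
    exact this
  · exact κ.1.isLt

/-- A set incoming variable of a clone of node `k` is a demand across the cut `k + 1`. [folklore] -/
theorem mem_dem_of_mem_ins {k : ℕ} (κ : N.Clone D) (hκ : κ.1.val = k) (β : N.Var D → Bool)
    (v : N.Var D) (hv : v ∈ N.ins D κ) (hβ : β v = true) : v ∈ N.dem D (k + 1) β := by
  unfold dem
  rw [Finset.mem_filter]
  refine ⟨Finset.mem_univ _, hβ, ?_, ⟨(κ.1.val, κ.2.val), N.tgtN_of_mem_ins D κ v hv, by simp [hκ]⟩⟩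
  have := N.lt_src_of_mem_ins D κ v hv
  omega

/-- The range of a valid... any clone of a node `< m` is nonempty (`fd ≥ 1`). [folklore] -/
theorem rangeOf_nonempty (κ : ℕ × ℕ) (hκ : κ.1 < N.m) : κ.2 ∈ N.rangeOf κ := by
  unfold rangeOf
  rw [Finset.mem_Ico]
  have := N.one_le_fd κ.1 hκ
  omega

/-- **The inputs that matter.** Under a valid demand across the cut `k + 1`, every clone of the
node `k` has at most one set incoming variable. [cite: MalodPortier2008, Thm. 2] -/
theorem countP_ins_le_one {k : ℕ} (β : N.Var D → Bool) (hval : N.Valid D (k + 1) β)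
    (κ : N.Clone D) (hκ : κ.1.val = k) : (N.ins D κ).countP (fun v => β v) ≤ 1 := by
  rw [List.countP_eq_length_filter]
  by_contra h
  have h1 : 1 < ((N.ins D κ).filter (fun v => β v)).length := lt_of_not_ge h
  set l := (N.ins D κ).filter (fun v => β v) with hl
  have hnd : l.Nodup := (N.nodup_ins D κ).filter _
  have h0 : 0 < l.length := by omega
  have hne : l[0] ≠ l[1] := fun heq => by
    have := (hnd.getElem_inj_iff).1 heq
    exact absurd this (by decide)
  have hmem : ∀ i (hi : i < l.length), l[i] ∈ N.ins D κ ∧ β l[i] = true := fun i hi => by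
    have hin : l[i] ∈ (N.ins D κ).filter (fun v => β v) := List.getElem_mem hi
    rw [List.mem_filter] at hin
    exact ⟨hin.1, by simpa using hin.2⟩
  have hd := hval _ (N.mem_dem_of_mem_ins D κ hκ β _ (hmem 0 h0).1 (hmem 0 h0).2)
    _ (N.mem_dem_of_mem_ins D κ hκ β _ (hmem 1 h1).1 (hmem 1 h1).2) hne
  have ht : ∀ i (hi : i < l.length), N.tgtN D l[i] = (κ.1.val, κ.2.val) := fun i hi => by
    unfold tgtN
    rw [N.tgtN_of_mem_ins D κ _ (hmem i hi).1]
    rfl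
  rw [ht 0 h0, ht 1 h1] at hd
  have hx := N.rangeOf_nonempty (κ.1.val, κ.2.val) κ.1.isLt
  exact Finset.disjoint_left.1 hd hx hx

/-- Hence the clone factors of node `k` are evaluated on inputs that matter. [folklore] -/
theorem care_of_valid {k : ℕ} (β : N.Var D → Bool) (hval : N.Valid D (k + 1) β)
    (κ : N.Clone D) (hκ : κ.1.val = k) (b : N.Var D → Bool)
    (hb : ∀ v, k < N.src D v → b v = β v) : (N.cloneKind D κ).Care b := by
  unfold FKind.Care
  by_cases hv : N.CValid D κ
  · rw [N.cloneKind_ins D κ hv]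
    have : (N.ins D κ).countP (fun v => b v) = (N.ins D κ).countP (fun v => β v) := by
      refine List.countP_congr fun v hv' => ?_
      rw [hb v (hκ ▸ N.lt_src_of_mem_ins D κ v hv')]
    rw [this]
    exact N.countP_ins_le_one D β hval κ hκ
  · rw [N.cloneKind_of_not D κ hv]
    simp [FKind.ins]

/-! ### Splitting the demand across the cut -/

/-- The demand across `k + 1` targeting nodes `< k` (it stays across the cut `k`). [folklore] -/
noncomputable def demLow (k : ℕ) (β : N.Var D → Bool) : Finset (N.Var D) :=
  (N.dem D (k + 1) β).filter fun v => (N.tgtN D v).1 < k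

/-- The demand across `k + 1` targeting the node `k` (consumed at the node `k`). [folklore] -/
noncomputable def demAt (k : ℕ) (β : N.Var D → Bool) : Finset (N.Var D) :=
  (N.dem D (k + 1) β).filter fun v => (N.tgtN D v).1 = k

/-- Membership in the demand across a cut, unfolded. [folklore] -/
theorem mem_dem {k : ℕ} {β : N.Var D → Bool} {v : N.Var D} :
    v ∈ N.dem D k β ↔ β v = true ∧ k ≤ N.src D v ∧ (N.tgtV D v).isSome ∧ (N.tgtN D v).1 < k := by
  unfold dem tgtN
  rw [Finset.mem_filter]
  simp only [Finset.mem_univ, true_and]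
  constructor
  · rintro ⟨hb, hs, κ, hκ, hlt⟩
    refine ⟨hb, hs, by simp [hκ], ?_⟩
    simpa [hκ] using hlt
  · rintro ⟨hb, hs, hsome, hlt⟩
    obtain ⟨κ, hκ⟩ := Option.isSome_iff_exists.1 hsome
    refine ⟨hb, hs, κ, hκ, ?_⟩
    simpa [hκ] using hlt

/-- `dem_{k+1} = demLow ⊔ demAt`. [folklore] -/
theorem dem_succ_eq (k : ℕ) (β : N.Var D → Bool) :
    N.dem D (k + 1) β = N.demLow D k β ∪ N.demAt D k β := by
  ext v
  unfold demLow demAt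
  simp only [Finset.mem_union, Finset.mem_filter]
  constructor
  · intro h
    have := (N.mem_dem D).1 h
    by_cases hlt : (N.tgtN D v).1 < k
    · exact Or.inl ⟨h, hlt⟩
    · exact Or.inr ⟨h, by omega⟩
  · rintro (⟨h, -⟩ | ⟨h, -⟩) <;> exact h

/-- `demLow` and `demAt` are disjoint. [folklore] -/
theorem disjoint_demLow_demAt (k : ℕ) (β : N.Var D → Bool) :
    Disjoint (N.demLow D k β) (N.demAt D k β) := by
  unfold demLow demAt
  rw [Finset.disjoint_filter]
  intro v _ h1 h2
  omega

/-- The set out-tokens of the node `k` targeting below (all of them do). [folklore] -/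
noncomputable def newOut (k : ℕ) (β' : N.Var D → Bool) : Finset (N.Var D) :=
  univ.filter fun v => β' v = true ∧ N.src D v = k ∧ (N.tgtV D v).isSome

/-- A demand variable with source `k < m` is a token of a clone of node `k`, and targets below `k`. [folklore] -/
theorem tgtN_lt_of_src {k : ℕ} (hk : k < N.m) (v : N.Var D) (hs : N.src D v = k)
    (hsome : (N.tgtV D v).isSome) : (N.tgtN D v).1 < k := by
  rcases v with τ | ⟨⟨⟩⟩ | q
  · simp only [tgtN, tgtV, Option.getD_some]
    have := (N.tgt_spec D τ).1
    simp only [src] at hs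
    omega
  · simp [src] at hs; omega
  · simp [tgtV] at hsome

/-- **The demand across the cut `k` of an extension**: the old demand targeting below `k`, plus
the set out-tokens of the node `k`. [folklore] -/
theorem dem_of_ext {k : ℕ} (hk : k < N.m) (β : N.Var D → Bool) (β' : N.Var D → Bool)
    (hβ' : β' ∈ N.Ext D k β) : N.dem D k β' = N.demLow D k β ∪ N.newOut D k β' := by
  unfold Ext at hβ'
  rw [Finset.mem_filter] at hβ'
  obtain ⟨-, hag, hzero⟩ := hβ'
  ext v
  rw [Finset.mem_union, N.mem_dem D]
  unfold demLow newOut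
  rw [Finset.mem_filter, N.mem_dem D, Finset.mem_filter]
  simp only [Finset.mem_univ, true_and]
  constructor
  · rintro ⟨hb, hs, hsome, hlt⟩
    by_cases heq : N.src D v = k
    · exact Or.inr ⟨hb, heq, hsome⟩
    · left
      have hs' : k + 1 ≤ N.src D v := by omega
      refine ⟨⟨?_, hs', hsome, by omega⟩, hlt⟩
      rw [← hag v hs']
      exact hb
  · rintro (⟨⟨hb, hs, hsome, -⟩, hlt⟩ | ⟨hb, hs, hsome⟩)
    · refine ⟨?_, by omega, hsome, hlt⟩
      rw [hag v hs]
      exact hb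
    · exact ⟨hb, hs.ge, hsome, N.tgtN_lt_of_src D hk v hs hsome⟩

/-- `demLow` and the new out-tokens are disjoint (sources differ). [folklore] -/
theorem disjoint_demLow_newOut (k : ℕ) (β β' : N.Var D → Bool) :
    Disjoint (N.demLow D k β) (N.newOut D k β') := by
  unfold demLow newOut
  rw [Finset.disjoint_left]
  intro v h1 h2
  rw [Finset.mem_filter, N.mem_dem D] at h1
  rw [Finset.mem_filter] at h2
  have := h1.1.2.1
  have := h2.2.2.1
  omega

/-- **`RHS_{k+1}` split along `demLow ⊔ demAt`**, with `val_e k` on `demAt`. [folklore] -/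
theorem RHS_succ_eq (k : ℕ) (β : N.Var D → Bool) :
    N.RHS D (k + 1) β = ∑ e ∈ N.Rep (k + 1),
      (∏ v ∈ N.demLow D k β, N.val (N.ext e) (N.tgtN D v).1) *
        (N.val (N.ext e) k) ^ (N.demAt D k β).card := by
  unfold RHS
  refine Finset.sum_congr rfl fun e _ => ?_
  rw [N.dem_succ_eq D k β, Finset.prod_union (N.disjoint_demLow_demAt D k β)]
  congr 1
  rw [← Finset.prod_const]
  refine Finset.prod_congr rfl fun v hv => ?_
  unfold demAt at hv
  rw [Finset.mem_filter] at hv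
  rw [hv.2]

/-! ### The factors of a node as a product over offsets -/

/-- The clone code `(k, c)`. [folklore] -/
def cl {k : ℕ} (hk : k < N.m) (c : Fin (D + 1)) : N.Clone D := (⟨k, hk⟩, c)

/-- The factors of a node `k ≥ u` (not a Boolean leaf) are its clone factors. [folklore] -/
theorem filter_nodeΦ_eq {k : ℕ} (hk : k < N.m) (hku : N.u ≤ k) :
    (univ.filter fun x : N.Φ D => N.nodeΦ D x = k) =
      (univ : Finset (Fin (D + 1))).map ⟨fun c => Sum.inl (N.cl D hk c), fun c c' h => by
        simpa [cl] using h⟩ := by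
  ext x
  simp only [Finset.mem_filter, Finset.mem_univ, true_and, Finset.mem_map, Function.Embedding.coeFn_mk]
  constructor
  · intro h
    rcases x with κ | ⟨z⟩ | k'
    · refine ⟨κ.2, ?_⟩
      simp only [nodeΦ] at h
      unfold cl
      congr 1
      ext <;> simp [h]
    · simp [nodeΦ] at h; omega
    · simp [nodeΦ] at h
      have := k'.isLt
      omega
  · rintro ⟨c, rfl⟩
    rfl

/-- **`prodAt` over offsets** for a node that is not a Boolean leaf. [folklore] -/
theorem prodAt_eq {k : ℕ} (hk : k < N.m) (hku : N.u ≤ k) (F : Fin (N.mF D) → (N.Var D → Bool) → R)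
    (b : N.Var D → Bool) :
    N.prodAt D F k b = ∏ c : Fin (D + 1), F (N.enc D (Sum.inl (N.cl D hk c))) b := by
  unfold prodAt
  rw [N.filter_nodeΦ_eq D hk hku, Finset.prod_map]
  rfl

/-- The factors of a Boolean leaf `k < u`: its clone factors and its chain end. [folklore] -/
theorem filter_nodeΦ_eq_evar {k : ℕ} (hku : k < N.u) :
    (univ.filter fun x : N.Φ D => N.nodeΦ D x = k) =
      insert (Sum.inr (Sum.inr ⟨k, hku⟩))
        ((univ : Finset (Fin (D + 1))).map ⟨fun c => Sum.inl (N.cl D (lt_of_lt_of_le hku N.u_le) c),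
          fun c c' h => by simpa [cl] using h⟩) := by
  ext x
  simp only [Finset.mem_filter, Finset.mem_univ, true_and, Finset.mem_insert, Finset.mem_map,
    Function.Embedding.coeFn_mk]
  constructor
  · intro h
    rcases x with κ | ⟨z⟩ | k'
    · right
      refine ⟨κ.2, ?_⟩
      simp only [nodeΦ] at h
      unfold cl
      congr 1
      ext <;> simp [h]
    · simp [nodeΦ] at h
      have := N.u_le
      omega
    · left
      simp only [nodeΦ] at h
      congr
      exact Fin.ext h
  · rintro (rfl | ⟨c, rfl⟩) <;> rfl

/-- **`prodAt` over offsets** for a Boolean leaf. [folklore] -/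
theorem prodAt_eq_evar {k : ℕ} (hku : k < N.u) (F : Fin (N.mF D) → (N.Var D → Bool) → R)
    (b : N.Var D → Bool) :
    N.prodAt D F k b = F (N.enc D (Sum.inr (Sum.inr ⟨k, hku⟩))) b *
      ∏ c : Fin (D + 1), F (N.enc D (Sum.inl (N.cl D (lt_of_lt_of_le hku N.u_le) c))) b := by
  unfold prodAt
  rw [N.filter_nodeΦ_eq_evar D hku, Finset.prod_insert, Finset.prod_map]
  · rfl
  · simp

/-- **Admissible realisations on the node `k`**: under a valid demand across `k + 1`, every clone
factor of node `k` takes its specified value at any `b` agreeing with `β` above `k`. [folklore] -/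
theorem F_cl_eq_spec {k : ℕ} (hk : k < N.m) (hroot : N.fd (N.m - 1) ≤ D)
    (F : Fin (N.mF D) → (N.Var D → Bool) → R) (hF : (N.FS D hD hm hroot).Admissible F)
    (β : N.Var D → Bool) (hval : N.Valid D (k + 1) β) (b : N.Var D → Bool)
    (hb : ∀ v, k < N.src D v → b v = β v) (c : Fin (D + 1)) :
    F (N.enc D (Sum.inl (N.cl D hk c))) b = (N.cloneKind D (N.cl D hk c)).spec b := by
  have h := hF.2 (N.enc D (Sum.inl (N.cl D hk c))) b
  simp only [FS, kindF_enc, kindΦ_inl] at h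
  exact h (N.care_of_valid D β hval _ rfl b hb)

/-! ### Demanded offsets of a node -/

/-- The clone `(k, c)` is demanded by `β`: some incoming variable is set. [folklore] -/
noncomputable def sdem {k : ℕ} (hk : k < N.m) (β : N.Var D → Bool) (c : Fin (D + 1)) : Bool :=
  (N.ins D (N.cl D hk c)).any β

/-- `any` over the incoming list only reads variables above `k`. [folklore] -/
theorem any_ins_congr {k : ℕ} (hk : k < N.m) (β b : N.Var D → Bool)
    (hb : ∀ v, k < N.src D v → b v = β v) (c : Fin (D + 1)) :
    (N.ins D (N.cl D hk c)).any b = N.sdem D hk β c := by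
  unfold sdem
  rw [Bool.eq_iff_iff, List.any_eq_true, List.any_eq_true]
  constructor
  · rintro ⟨v, hv, hbv⟩
    exact ⟨v, hv, by rw [← hb v (N.lt_src_of_mem_ins D _ v hv)]; exact hbv⟩
  · rintro ⟨v, hv, hbv⟩
    exact ⟨v, hv, by rw [hb v (N.lt_src_of_mem_ins D _ v hv)]; exact hbv⟩

/-- A demanded clone is valid (it is the target of a token, or the root). [folklore] -/
theorem cvalid_of_sdem {k : ℕ} (hk : k < N.m) (hm : 0 < N.m) (hroot : N.fd (N.m - 1) ≤ D) (β : N.Var D → Bool)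
    (c : Fin (D + 1)) (h : N.sdem D hk β c = true) : N.CValid D (N.cl D hk c) := by
  unfold sdem at h
  obtain ⟨v, hv, -⟩ := List.any_eq_true.1 h
  rcases (N.mem_ins_iff D _ v).1 hv with ⟨τ, rfl, hτ⟩ | ⟨hr, -⟩
  · have hC : N.tgtC D τ = N.cl D hk c := by
      unfold tgtC mkClone cl
      ext <;> simp [hτ, cl]
    rw [← hC]
    exact N.tgtC_valid D τ
  · rw [N.eq_rootC_of_isRoot D (hm := hm) hr]
    exact N.rootC_valid D hm hroot

/-- A demand variable consumed at node `k` is an incoming variable of the clone it targets. [folklore] -/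
theorem mem_ins_of_mem_demAt {k : ℕ} (hk : k < N.m) (β : N.Var D → Bool) (v : N.Var D)
    (hv : v ∈ N.demAt D k β) :
    ∃ c : Fin (D + 1), N.tgtN D v = (k, c.val) ∧ v ∈ N.ins D (N.cl D hk c) ∧ β v = true := by
  unfold demAt at hv
  rw [Finset.mem_filter, N.mem_dem D] at hv
  obtain ⟨⟨hb, hs, hsome, -⟩, hk'⟩ := hv
  rcases v with τ | ⟨⟨⟩⟩ | q
  · have ht2 : (N.tgt D τ).2 ≤ D := by have := (N.tgt_spec D τ).2.1; omega
    refine ⟨⟨(N.tgt D τ).2, Nat.lt_succ_of_le ht2⟩, ?_, ?_, hb⟩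
    · simp only [tgtN, tgtV, Option.getD_some] at hk' ⊢
      ext <;> simp [hk']
    · rw [N.mem_ins_iff D]
      left
      refine ⟨τ, rfl, ?_⟩
      simp only [tgtN, tgtV, Option.getD_some] at hk'
      simp [cl, ← hk']
  · refine ⟨0, ?_, ?_, hb⟩
    · simp only [tgtN, tgtV, Option.getD_some] at hk' ⊢
      simp [← hk']
    · rw [N.mem_ins_iff D]
      right
      simp only [tgtN, tgtV, Option.getD_some] at hk'
      exact ⟨⟨by simp [cl, ← hk'], rfl⟩, rfl⟩
  · simp [tgtV] at hsome

/-- Conversely a set incoming variable of `(k, c)` is consumed at node `k`. [folklore] -/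
theorem mem_demAt_of_mem_ins {k : ℕ} (hk : k < N.m) (β : N.Var D → Bool) (c : Fin (D + 1))
    (v : N.Var D) (hv : v ∈ N.ins D (N.cl D hk c)) (hb : β v = true) :
    v ∈ N.demAt D k β ∧ N.tgtN D v = (k, c.val) := by
  have ht : N.tgtN D v = (k, c.val) := by
    unfold tgtN
    rw [N.tgtN_of_mem_ins D _ v hv]
    rfl
  refine ⟨?_, ht⟩
  unfold demAt
  rw [Finset.mem_filter]
  exact ⟨N.mem_dem_of_mem_ins D _ rfl β v hv hb, by rw [ht]⟩

/-- Two distinct set demand variables cannot target the same clone. [folklore] -/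
theorem eq_of_tgtN_eq {k : ℕ} (β : N.Var D → Bool) (hval : N.Valid D (k + 1) β) (v w : N.Var D)
    (hv : v ∈ N.dem D (k + 1) β) (hw : w ∈ N.dem D (k + 1) β) (ht : N.tgtN D v = N.tgtN D w)
    (hlt : (N.tgtN D v).1 < N.m) : v = w := by
  by_contra hne
  have hd := hval v hv w hw hne
  rw [ht] at hd
  have hx := N.rangeOf_nonempty (N.tgtN D w) (ht ▸ hlt)
  exact Finset.disjoint_left.1 hd hx hx

/-- **Demanded offsets ↔ consumed demand.** Under validity the map `v ↦ offset of its target`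
is a bijection from `demAt k β` onto the demanded offsets. [folklore] -/
theorem card_demAt_eq {k : ℕ} (hk : k < N.m) (β : N.Var D → Bool) (hval : N.Valid D (k + 1) β) :
    (N.demAt D k β).card = (univ.filter fun c : Fin (D + 1) => N.sdem D hk β c = true).card := by
  classical
  refine Finset.card_bij (fun v hv => Classical.choose (N.mem_ins_of_mem_demAt D hk β v hv))
    (fun v hv => ?_) (fun v hv w hw h => ?_) (fun c hc => ?_)
  · obtain ⟨-, hins, hb⟩ := Classical.choose_spec (N.mem_ins_of_mem_demAt D hk β v hv)
    rw [Finset.mem_filter]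
    exact ⟨Finset.mem_univ _, List.any_eq_true.2 ⟨v, hins, hb⟩⟩
  · obtain ⟨htv, -, -⟩ := Classical.choose_spec (N.mem_ins_of_mem_demAt D hk β v hv)
    obtain ⟨htw, -, -⟩ := Classical.choose_spec (N.mem_ins_of_mem_demAt D hk β w hw)
    rw [h] at htv
    have hv' : v ∈ N.dem D (k + 1) β := (Finset.mem_filter.1 hv).1
    have hw' : w ∈ N.dem D (k + 1) β := (Finset.mem_filter.1 hw).1
    exact N.eq_of_tgtN_eq D β hval v w hv' hw' (htv.trans htw.symm) (by rw [htv]; exact hk)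
  · rw [Finset.mem_filter] at hc
    obtain ⟨v, hins, hb⟩ := List.any_eq_true.1 hc.2
    obtain ⟨hv, ht⟩ := N.mem_demAt_of_mem_ins D hk β c v hins hb
    refine ⟨v, hv, ?_⟩
    obtain ⟨ht', -, -⟩ := Classical.choose_spec (N.mem_ins_of_mem_demAt D hk β v hv)
    have h2 := congrArg Prod.snd (ht.symm.trans ht')
    exact Fin.ext (by simpa using h2.symm)


end NCirc

end Literature.Computability.AlgebraicComplexity
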